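import Summits.AtomisticToContinuum.BoseEinsteinCondensation.Theorems.BECInsertionCorrectorCorrectorClosureTiltCorrectorLift
import HarnessLib

/-!
# The removal energy budget, I: the `(N+1)`-body Euler–Lagrange equation integrated over the
# removed particle (line `zero-mode-removal-susceptibility` / `volume-homotopy-sum-rule-domination`,
# helpers for the registered stub `stub_removalEnergyBudget`, crux
# `BECInsertionCorrector.CorrectorClosure`, item stmt-AtomisticToContinuum-12058)

Supports (does not close) stmt-AtomisticToContinuum-12058. For a measurable pair profile `w` with
bounded periodisation `w^per ≤ C`, a box `L > 0` and a real positive `C¹` periodic `(N+1)`-body state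
`Φ` attaining the finite periodic ground-state energy `E₀(N+1)`, write `b = |Φ|` and let
`G(Y) = ∫_{[0,L)³} b(x, Y) dx` be the zero-mode REMOVAL amplitude (particle `0` integrated out over
the cell). Then (`reb_removal_firstMoment`)

`∫_{cell^N} |∇G|² + ∫_{cell^N} V_N G² ≤ E₀(N+1) ∫_{cell^N} G²`,

i.e. `⟨G, H_N G⟩ ≤ E₀(N+1) ‖G‖²`: the removal state is an `N`-body trial state of energy at most
`E₀(N+1)`. Proof: the weak Euler–Lagrange equation of `Φ`, valid for ALL lattice-periodic `C¹`
test functions (`tilt_el_all`), is tested on `ζ = (G∘tail)/b`, i.e. `H_{N+1}Φ = E₀(N+1)Φ` is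
paired with `u(x, Y) = G(Y)`; Fubini `cell^{N+1} = cell^N × cell` with the removed coordinate
innermost turns `∫ u b` into `∫ G²`, `∫ ∇b·∇u` into `∫ |∇G|²` (the `x`-gradient of `u` vanishes and
`∂_{j,k} G = ∫_cell ∂_{j+1,k} b dx`, differentiation under the cell integral, `pderiv_modeCoeff`),
and the pair sum splits `V_{N+1}(x, Y) = ∑ⱼ w^per(x − yⱼ) + V_N(Y)` with the impurity–bath term
`∫ G ∑ⱼ w^per b ≥ 0` DROPPED (`G, w^per, b ≥ 0`).

Contents: Fubini on the cell for an integrable real function with the tagged coordinate innermost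
(`reb_setIntegral_cellN_succ_right`), the removal amplitude of a periodic test function is a periodic
test function with `∂G = ∫_cell ∂b` (`reb_isPeriodicTest_removal`, `reb_pderiv_removal`), the slice
identity `∫_cell ∇b·∇(G∘tail) (x, Y) dx = |∇G|²(Y)` (`reb_integral_cell_gradDot_slice`), and the budget.

References: M. Reed, B. Simon, *Methods of Modern Mathematical Physics IV* (1978), §XIII.1
(Rayleigh–Ritz); E. B. Davies, *Heat kernels and spectral theory* (1989), §4.2.
-/

noncomputable section

namespace Summit.AtomisticToContinuum.BoseEinsteinCondensation.Theorems.CorrectorClosure.ZeroModeRemovalSusceptibility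

open MeasureTheory Filter Matrix
open scoped ENNReal NNReal BigOperators
open Literature.MathematicalPhysics.QuantumManyBody.BoseGas
open Summit.AtomisticToContinuum.BoseEinsteinCondensation.Theorems.CorrectorClosure.GeometricMeanCorrector
  (tilt_el_all tilt_toReal_periodicInteraction_succ tilt_gradDot_tail_vecCons tilt_pderiv_vecCons_slice
    tilt_contDiff_comp_tail tilt_tail_single_zero tilt_tail_single_succ mixedLaw_tail_vecCons)
open Summit.AtomisticToContinuum.BoseEinsteinCondensation.Theorems.CorrectorClosure.HealingScaleKacInsertion
  (isPeriodicTest_modeCoeff pderiv_modeCoeff)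
open Summit.AtomisticToContinuum.BoseEinsteinCondensation.Cruxes.StaticResponseBound.UvThomsonForceWave
  (contDiff_norm_of_real measurable_periodicInteraction_of)

variable {N : ℕ} {L : ℝ}

/-! ### Fubini on the cell, tagged coordinate innermost, for an integrable real function -/

/-- **Fubini on the cell for an integrable real function, tagged coordinate innermost**:
`∫_{[0,L)^{3(N+1)}} H = ∫_{[0,L)^{3N}} (∫_{[0,L)³} H(x₀, Y) dx₀) dY`. [folklore] -/
theorem reb_setIntegral_cellN_succ_right {H : Config (N + 1) → ℝ}
    (hH : IntegrableOn H (cellN (N + 1) L)) :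
    ∫ X in cellN (N + 1) L, H X = ∫ Y in cellN N L, ∫ x in cell L, H (vecCons x Y) := by
  -- adapted from `tilt_setIntegral_cellN_succ_left` (tagged coordinate outermost)
  have hint : Integrable (fun p : Space × Config N => H (vecCons p.1 p.2))
      ((volume.restrict (cell L)).prod (volume.restrict (cellN N L))) := by
    have h := ((measurePreserving_vecCons (n := N)).integrableOn_comp_preimage
      measurableEmbedding_vecCons (f := H) (s := cellN (N + 1) L)).2 hH
    rw [vecCons_preimage_cellN] at h
    rw [Measure.prod_restrict]
    exact h
  calc ∫ X in cellN (N + 1) L, H X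
      = ∫ p in (fun p : Space × Config N => (vecCons p.1 p.2 : Config (N + 1))) ⁻¹'
            cellN (N + 1) L, H (vecCons p.1 p.2) ∂(volume.prod volume) :=
        ((measurePreserving_vecCons (n := N)).setIntegral_preimage_emb
          measurableEmbedding_vecCons H _).symm
    _ = ∫ p, H (vecCons p.1 p.2)
          ∂((volume.restrict (cell L)).prod (volume.restrict (cellN N L))) := by
        rw [vecCons_preimage_cellN, Measure.prod_restrict]
    _ = ∫ Y in cellN N L, ∫ x in cell L, H (vecCons x Y) :=
        integral_prod_symm (fun p : Space × Config N => H (vecCons p.1 p.2)) hint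

/-! ### The removal amplitude of a periodic test function -/

/-- **The removal amplitude of a periodic test function is a periodic test function**: for a
periodic `C¹` function `b` on `(ℝ³)^{N+1}`, `Y ↦ ∫_{[0,L)³} b(x, Y) dx` is `C¹` and lattice periodic
(the mode coefficient of `b` against the constant weight `1`). [folklore] -/
theorem reb_isPeriodicTest_removal (hL : 0 < L) {b : Config (N + 1) → ℝ} (hb : IsPeriodicTest L b)
    {G : Config N → ℝ} (hG : ∀ Y, G Y = ∫ x in cell L, b (vecCons x Y)) : IsPeriodicTest L G := by
  rw [show G = fun Y => ∫ x in cell L, b (vecCons x Y) from funext hG]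
  simpa only [one_mul] using
    isPeriodicTest_modeCoeff (N := N) hL hb (w := fun _ : Space => (1 : ℝ)) continuous_const

/-- **Differentiation of the removal amplitude under the cell integral**:
`∂_{j,k} ∫_{[0,L)³} b(x, Y) dx = ∫_{[0,L)³} ∂_{j+1,k} b(x, Y) dx`. [folklore] -/
theorem reb_pderiv_removal (hL : 0 < L) {b : Config (N + 1) → ℝ} (hb : IsPeriodicTest L b)
    {G : Config N → ℝ} (hG : ∀ Y, G Y = ∫ x in cell L, b (vecCons x Y)) (Y : Config N) (j : Fin N)
    (k : Fin 3) : pderiv j k G Y = ∫ x in cell L, pderiv j.succ k b (vecCons x Y) := by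
  rw [show G = fun Y => ∫ x in cell L, b (vecCons x Y) from funext hG]
  simpa only [one_mul] using
    pderiv_modeCoeff (N := N) hL hb (w := fun _ : Space => (1 : ℝ)) continuous_const Y j k

/-- **The slice identity for the kinetic pairing**: for a periodic test function `b` on
`(ℝ³)^{N+1}` with removal amplitude `G`, `∫_{[0,L)³} ∇b·∇(G∘tail) (x, Y) dx = |∇G|²(Y)` (the
`x`-components of `∇(G∘tail)` vanish, the bath components are `∇G(Y)`, and
`∫_cell ∂_{j+1,k} b(x, Y) dx = ∂_{j,k} G(Y)`). [folklore] -/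
theorem reb_integral_cell_gradDot_slice (hL : 0 < L) {b : Config (N + 1) → ℝ}
    (hb : IsPeriodicTest L b) {G : Config N → ℝ} (hG : ∀ Y, G Y = ∫ x in cell L, b (vecCons x Y))
    (Y : Config N) :
    ∫ x in cell L, gradDot b (fun W => G (Fin.tail W)) (vecCons x Y) = gradDot G G Y := by
  have hGt : IsPeriodicTest L G := reb_isPeriodicTest_removal hL hb hG
  have hGd : Differentiable ℝ G := hGt.differentiable
  have hbd : Differentiable ℝ b := hb.differentiable
  have hpt : ∀ x : Space, gradDot b (fun W => G (Fin.tail W)) (vecCons x Y) =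
      ∑ j : Fin N, ∑ k : Fin 3, pderiv j k G Y * pderiv j.succ k b (vecCons x Y) := by
    intro x
    rw [gradDot_comm, tilt_gradDot_tail_vecCons hGd hbd x Y]
    simp only [gradDot]
    refine Finset.sum_congr rfl fun j _ => Finset.sum_congr rfl fun k _ => ?_
    rw [tilt_pderiv_vecCons_slice hbd x Y j k]
  have hcont : ∀ (j : Fin N) (k : Fin 3),
      Continuous fun x : Space => pderiv j.succ k b (vecCons x Y) :=
    fun j k => (continuous_pderiv hb.1 _ _).comp (continuous_id.matrixVecCons continuous_const)
  have hint : ∀ (j : Fin N) (k : Fin 3),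
      Integrable (fun x : Space => pderiv j k G Y * pderiv j.succ k b (vecCons x Y))
        (volume.restrict (cell L)) :=
    fun j k => (integrableOn_cell (hcont j k)).const_mul _
  simp_rw [hpt]
  rw [integral_finsetSum _ fun j _ => integrable_finsetSum _ fun k _ => hint j k]
  unfold gradDot
  refine Finset.sum_congr rfl fun j _ => ?_
  rw [integral_finsetSum _ fun k _ => hint j k]
  refine Finset.sum_congr rfl fun k _ => ?_
  rw [integral_const_mul, ← reb_pderiv_removal hL hb hG Y j k]

/-- `G ∘ tail` is lattice periodic on `(ℝ³)^{N+1}` when `G` is lattice periodic on `(ℝ³)^N`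
(`tail (e_0 ⊗ v) = 0`, `tail (e_{j+1} ⊗ v) = e_j ⊗ v`). [folklore] -/
theorem reb_isLatticePeriodic_tail {G : Config N → ℝ} (hG : IsLatticePeriodic L G) :
    IsLatticePeriodic L fun Z : Config (N + 1) => G (Fin.tail Z) := by
  intro Z i k
  show G (Fin.tail (Z + _)) = G (Fin.tail Z)
  have htail_add : ∀ W : Config (N + 1), Fin.tail (Z + W) = Fin.tail Z + Fin.tail W := fun W => rfl
  obtain rfl | ⟨j, rfl⟩ := Fin.eq_zero_or_eq_succ i
  · rw [htail_add, tilt_tail_single_zero, add_zero]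
  · rw [htail_add, tilt_tail_single_succ, hG]

/-! ### The removal energy budget -/

/-- **The removal energy budget (first moment of the removal state).** For a measurable profile
`w` with bounded periodisation `w^per ≤ C`, `L > 0`, a real positive periodic trial state `Φ` of
`N + 1` bosons attaining the periodic ground-state energy (finite), `b = |Φ|` and the removal
amplitude `G(Y) = ∫_{[0,L)³} b(x, Y) dx`:
`∫_{cell^N} |∇G|² + ∫_{cell^N} V_N G² ≤ E₀(N+1) · ∫_{cell^N} G²` — the removal state `a₀Φ` is an
`N`-body trial state of energy at most `E₀(N+1)‖a₀Φ‖²`. Proof: test the weak Euler–Lagrange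
equation of `Φ` (`tilt_el_all`, all lattice-periodic `C¹` tests) on `ζ = (G∘tail)/b`; Fubini with
the removed coordinate innermost gives `∫ (G∘tail) b = ∫ G²` and `∫ ∇b·∇(G∘tail) = ∫ |∇G|²`
(`reb_integral_cell_gradDot_slice`); the pair sum splits as `V_{N+1} = W + V_N∘tail`
(`tilt_toReal_periodicInteraction_succ`) and the impurity–bath term `∫ W (G∘tail) b ≥ 0` is dropped.
[cite: ReedSimonIV1978, §XIII.1 (Rayleigh–Ritz)] -/
theorem reb_removal_firstMoment {w : ℝ → ℝ≥0∞} (hw : Measurable w) {C : ℝ≥0}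
    (hC : ∀ x, periodizedPotential w L x ≤ C) (hL : 0 < L) (Φ : PeriodicTrialState (N + 1) L)
    (hreal : ∀ Z, Φ.ψ Z = (‖Φ.ψ Z‖ : ℂ))
    (hE : periodicEnergy w Φ = periodicGroundStateEnergy w (N + 1) L)
    (hfin : periodicEnergy w Φ ≠ ⊤) {b : Config (N + 1) → ℝ} (hb : ∀ Z, ‖Φ.ψ Z‖ = b Z)
    (hb0 : ∀ Z, 0 < b Z) {G : Config N → ℝ} (hG : ∀ Y, G Y = ∫ x in cell L, b (vecCons x Y)) :
    (∫ Y in cellN N L, gradDot G G Y) +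
        (∫ Y in cellN N L, (periodicInteraction w L Y).toReal * G Y ^ 2) ≤
      (periodicGroundStateEnergy w (N + 1) L).toReal * ∫ Y in cellN N L, G Y ^ 2 := by
  -- `b = |Φ|` is a positive periodic test function
  have hbfun : (fun Z => ‖Φ.ψ Z‖) = b := funext hb
  have hbC : ContDiff ℝ 1 b := by rw [← hbfun]; exact contDiff_norm_of_real Φ hreal
  have hbper : IsLatticePeriodic L b := by
    intro Z i k
    rw [← hb, ← hb, Φ.periodic]
  have hbt : IsPeriodicTest L b := ⟨hbC, hbper⟩
  -- the removal amplitude `G` and the flat test function `u = G ∘ tail`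
  have hGt : IsPeriodicTest L G := reb_isPeriodicTest_removal hL hbt hG
  have hGC : ContDiff ℝ 1 G := hGt.1
  have hG0 : ∀ Y, 0 ≤ G Y := fun Y => by
    rw [hG]; exact setIntegral_nonneg (measurableSet_cell L) fun x _ => (hb0 _).le
  have huC : ContDiff ℝ 1 fun W : Config (N + 1) => G (Fin.tail W) := tilt_contDiff_comp_tail hGC
  have huper : IsLatticePeriodic L fun W : Config (N + 1) => G (Fin.tail W) :=
    reb_isLatticePeriodic_tail hGt.2
  -- the test function `ζ = u / b`
  obtain ⟨ζ, hζ⟩ : ∃ ζ : Config (N + 1) → ℝ, ζ = fun Z => G (Fin.tail Z) / b Z := ⟨_, rfl⟩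
  have hζC : ContDiff ℝ 1 ζ := by rw [hζ]; exact huC.div hbC fun Z => (hb0 Z).ne'
  have hζper : IsLatticePeriodic L ζ := by
    rw [hζ]; intro Z i k
    show G (Fin.tail (Z + _)) / b (Z + _) = G (Fin.tail Z) / b Z
    have hu : G (Fin.tail (Z + Pi.single i (EuclideanSpace.single k L))) = G (Fin.tail Z) :=
      huper Z i k
    rw [hbper, hu]
  have hζb : (fun W => ζ W * b W) = fun W => G (Fin.tail W) := by
    funext W; rw [hζ]; exact div_mul_cancel₀ _ (hb0 W).ne'
  have hζb2 : ∀ Z, ζ Z * b Z ^ 2 = G (Fin.tail Z) * b Z := fun Z => by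
    rw [hζ, sq, ← mul_assoc, div_mul_cancel₀ _ (hb0 Z).ne']
  -- the Euler–Lagrange equation of `Φ` tested on `ζ`
  have hel : (∫ Z in cellN (N + 1) L, gradDot b (fun W => G (Fin.tail W)) Z) +
      (∫ Z in cellN (N + 1) L, (periodicInteraction w L Z).toReal * (G (Fin.tail Z) * b Z)) =
      (periodicGroundStateEnergy w (N + 1) L).toReal *
        ∫ Z in cellN (N + 1) L, G (Fin.tail Z) * b Z := by
    have h := tilt_el_all (M := N + 1) hw hreal hE hfin hζC hζper
    rw [hE] at h
    simp only [hb] at h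
    rw [hζb] at h
    have e2 : ∫ Z in cellN (N + 1) L, (periodicInteraction w L Z).toReal * ζ Z * b Z ^ 2 =
        ∫ Z in cellN (N + 1) L, (periodicInteraction w L Z).toReal * (G (Fin.tail Z) * b Z) :=
      integral_congr_ae (ae_of_all _ fun Z => by dsimp only; rw [mul_assoc, hζb2])
    have e3 : ∫ Z in cellN (N + 1) L, ζ Z * b Z ^ 2 =
        ∫ Z in cellN (N + 1) L, G (Fin.tail Z) * b Z :=
      integral_congr_ae (ae_of_all _ fun Z => hζb2 Z)
    rw [e2, e3] at h
    exact h
  -- the kinetic term: `∫ ∇b·∇u = ∫ |∇G|²`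
  have hT1 : ∫ Z in cellN (N + 1) L, gradDot b (fun W => G (Fin.tail W)) Z =
      ∫ Y in cellN N L, gradDot G G Y := by
    rw [setIntegral_cellN_succ_right_of_continuous (L := L) (continuous_gradDot hbC huC)]
    exact integral_congr_ae (ae_of_all _ fun Y => reb_integral_cell_gradDot_slice hL hbt hG Y)
  -- the mass term: `∫ u b = ∫ G²`
  have hT3 : ∫ Z in cellN (N + 1) L, G (Fin.tail Z) * b Z = ∫ Y in cellN N L, G Y ^ 2 := by
    rw [setIntegral_cellN_succ_right_of_continuous (L := L) (F := fun Z => G (Fin.tail Z) * b Z)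
      (huC.continuous.mul hbC.continuous)]
    refine integral_congr_ae (ae_of_all _ fun Y => ?_)
    dsimp only
    simp only [mixedLaw_tail_vecCons]
    rw [integral_const_mul, ← hG, sq]
  -- the potential term: split `V_{N+1} = W + V_N ∘ tail`, drop `∫ W u b ≥ 0`, Fubini on the rest
  obtain ⟨Wp, hWp⟩ : ∃ Wp : Config (N + 1) → ℝ,
      Wp = fun Z => ∑ j : Fin N, (periodizedPotential w L (Z 0 - Z j.succ)).toReal := ⟨_, rfl⟩
  obtain ⟨U, hU⟩ : ∃ U : Config N → ℝ, U = fun Y => (periodicInteraction w L Y).toReal :=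
    ⟨_, rfl⟩
  have hU' : ∀ Y, (periodicInteraction w L Y).toReal = U Y := fun Y => by rw [hU]
  have hsplit : ∀ Z, (periodicInteraction w L Z).toReal = Wp Z + U (Fin.tail Z) := fun Z => by
    rw [hWp, hU]; exact tilt_toReal_periodicInteraction_succ hC Z
  have hWp0 : ∀ Z, 0 ≤ Wp Z := fun Z => by
    rw [hWp]; exact Finset.sum_nonneg fun j _ => ENNReal.toReal_nonneg
  have hWpbd : ∀ Z, |Wp Z| ≤ N * C := by
    intro Z
    rw [abs_of_nonneg (hWp0 Z), hWp]
    calc ∑ j : Fin N, (periodizedPotential w L (Z 0 - Z j.succ)).toReal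
        ≤ ∑ _j : Fin N, (C : ℝ) := Finset.sum_le_sum fun j _ => by
          have h := ENNReal.toReal_mono ENNReal.coe_ne_top (hC (Z 0 - Z j.succ))
          rwa [ENNReal.coe_toReal] at h
      _ = N * C := by simp
  have hWpm : Measurable Wp := by
    rw [hWp]
    refine Finset.measurable_sum _ fun j _ => ?_
    exact ((measurable_periodizedPotential hw L).comp
      ((measurable_config_apply 0).sub (measurable_config_apply j.succ))).ennreal_toReal
  have hUbd : ∀ Y, |U Y| ≤ ((N * N : ℕ) : ℝ) * C := fun Y => by
    rw [hU, abs_of_nonneg ENNReal.toReal_nonneg]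
    have h := ENNReal.toReal_mono (ENNReal.mul_ne_top (ENNReal.natCast_ne_top _) ENNReal.coe_ne_top)
      (periodicInteraction_le_of_bounded hC Y)
    rwa [ENNReal.toReal_mul, ENNReal.toReal_natCast, ENNReal.coe_toReal] at h
  have hUm : Measurable U := by
    rw [hU]; exact (measurable_periodicInteraction_of hw L).ennreal_toReal
  have iub : IntegrableOn (fun Z => G (Fin.tail Z) * b Z) (cellN (N + 1) L) :=
    integrableOn_cellN (huC.continuous.mul hbC.continuous) L
  have iW : IntegrableOn (fun Z => Wp Z * (G (Fin.tail Z) * b Z)) (cellN (N + 1) L) :=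
    Integrable.bdd_mul (c := N * C) iub hWpm.aestronglyMeasurable
      (ae_of_all _ fun Z => by rw [Real.norm_eq_abs]; exact hWpbd Z)
  have iU : IntegrableOn (fun Z => U (Fin.tail Z) * (G (Fin.tail Z) * b Z)) (cellN (N + 1) L) :=
    Integrable.bdd_mul (c := ((N * N : ℕ) : ℝ) * C) iub
      (hUm.comp (measurable_pi_lambda _ fun j => measurable_pi_apply (Fin.succ j))).aestronglyMeasurable
      (ae_of_all _ fun Z => by rw [Real.norm_eq_abs]; exact hUbd _)
  have hT2 : ∫ Z in cellN (N + 1) L, (periodicInteraction w L Z).toReal * (G (Fin.tail Z) * b Z) =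
      (∫ Z in cellN (N + 1) L, Wp Z * (G (Fin.tail Z) * b Z)) +
        ∫ Z in cellN (N + 1) L, U (Fin.tail Z) * (G (Fin.tail Z) * b Z) := by
    rw [← integral_add iW iU]
    exact integral_congr_ae (ae_of_all _ fun Z => by dsimp only; rw [hsplit, add_mul])
  have hT2a : 0 ≤ ∫ Z in cellN (N + 1) L, Wp Z * (G (Fin.tail Z) * b Z) :=
    setIntegral_nonneg (measurableSet_cellN _ _) fun Z _ =>
      mul_nonneg (hWp0 Z) (mul_nonneg (hG0 _) (hb0 Z).le)
  have hT2b : ∫ Z in cellN (N + 1) L, U (Fin.tail Z) * (G (Fin.tail Z) * b Z) =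
      ∫ Y in cellN N L, U Y * G Y ^ 2 := by
    rw [reb_setIntegral_cellN_succ_right iU]
    refine integral_congr_ae (ae_of_all _ fun Y => ?_)
    dsimp only
    simp only [mixedLaw_tail_vecCons]
    rw [integral_const_mul, integral_const_mul, ← hG, sq]
  -- assemble
  simp only [hU']
  rw [hT1, hT2, hT2b, hT3] at hel
  linarith

end Summit.AtomisticToContinuum.BoseEinsteinCondensation.Theorems.CorrectorClosure.ZeroModeRemovalSusceptibility

end
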